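import Literature.NumberTheory.Adeles.FiniteAdeleLatticeOfGL
import Literature.NumberTheory.Adeles.RatFiniteIdeleCongruenceClasses
import HarnessLib

/-!
# Level `N`: `Λ_a / N Λ_a ≃ (ℤ/N)ⁿ` through `q ↦ a⁻¹ q (mod N)` — the level structure of an adelic point

Topic `Literature/NumberTheory/Adeles`; namespace `Literature.NumberTheory.Adeles`.  THEOREMS ONLY (no definition, no named
fact, no instance, no `sorry`), over the carrier ★ `FiniteAdeleLatticeOfGL` (`latticeOfGL a = Λ_a = ℚⁿ ∩ a ℤ̂ⁿ`) and the
`integralAdeles` bridge of ★ `RatFiniteIdeleCongruenceClasses` (R60-12).  For `a ∈ GL_n(𝔸_{ℚ,f})` and `q ∈ Λ_a` the vector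
`a⁻¹ q` lies in `ℤ̂ⁿ`; reducing modulo `N·ℤ̂` (the cell's `levelIdeal N`):

* `forall_mulVec_mem_levelIdeal_iff` — KERNEL: `a⁻¹ q ∈ (N·ℤ̂)ⁿ ↔ q ∈ N Λ_a`;
* `exists_mem_latticeOfGL_mulVec_sub_mem_levelIdeal` — SURJECTIVITY: every `y ∈ ℤ̂ⁿ` is `≡ a⁻¹ q (mod N)` for some `q ∈ Λ_a`
  (strong approximation `𝔸_{ℚ,f} = ℚ + M ℤ̂`); with `exists_int_mulVec_sub_intCast_mem_levelIdeal` (integer representatives,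
  `ℤ̂/Nℤ̂ = ℤ/N`) this is the level-`N` structure `η_a : Λ_a/NΛ_a ≃ (ℤ/N)ⁿ` of [Milne2005ShimuraVarieties] §6 Thm. 6.11 p. 74 and
  the `V(ℤ̂)`/`K(N)`/level-`N` description p. 75 («By a level-`N` structure on `A`, we mean an isomorphism
  `η : V(ℤ/Nℤ) → A(ℂ)_N` …») / [Deligne1971TravauxShimura] 4.16–4.20 pp. 150–152, stated without quotient types;
* `inv_map_mul_mulVec_comp_mulVec` — `GL_n(ℚ)`-equivariance `(γa)⁻¹(γq) = a⁻¹ q`;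
* `mulVec_sub_mulVec_mem_levelIdeal_of_isCongOne` / `isCongOne_inv_of_forall_mulVec_sub_mulVec_mem_levelIdeal` — for `u ∈ GL_n(ℤ̂)`
  (`Λ_{au} = Λ_a`): `η_{au} ≡ η_a (mod N)` on `Λ_a` **iff** `u⁻¹ ≡ 1 (mod N)` (`IsCongOne N u⁻¹`), i.e. the level structure pins
  the coset `a K(N)`; `isCongOne_inv_of_isCongOne` — `u ≡ 1 ⇒ u⁻¹ ≡ 1` inside `GL_n(ℤ̂)`.

Cell `hodgecm-mathlib` (D-0151), #60 road leaf R60-19 (file 3 of 3).  Banked generic leaf; HC_CM is proved only modulo the printed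
citations until rung 0 closes; no floor change.

## References
* [Milne2005ShimuraVarieties] J. S. Milne, *Introduction to Shimura varieties* (2005; 2017 revision pages), §6 Thm. 6.11 p. 74
  (`T_f(A) = H₁(A, ℤ) ⊗ ℤ̂`, `V(𝔸_f) → V_f(A)`) and p. 75 (`V(ℤ̂)`, `K(N) = {g | g V(ℤ̂) = V(ℤ̂), g ≡ 1 on V(ℤ̂)/NV(ℤ̂)}`,
  `Γ(N)`, level-`N` structures `η : V(ℤ/Nℤ) → A(ℂ)_N`); §4 Thm. 4.16 p. 48 (strong approximation).
* [Deligne1971TravauxShimura] P. Deligne, *Travaux de Shimura* (1971), 4.16–4.20 pp. 150–152.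
-/

set_option autoImplicit false

noncomputable section

open scoped Matrix
open NumberField IsDedekindDomain Matrix
open Literature.NumberTheory.Automorphic (integralFiniteAdeles mem_integralFiniteAdeles_iff)
open Literature.AlgebraicGeometry.ModuliOfAbelianVarieties (finAdeleQ levelIdeal mem_levelIdeal_iff IsCongOne)

namespace Literature.NumberTheory.Adeles

variable {n : Type} [Fintype n] [DecidableEq n]

/-! ### §0. Plumbing (private copies of the carrier file's bookkeeping identities) -/

/-- The adelic image of `γ⁻¹` is the inverse of the adelic image of `γ` (as matrices). [folklore] -/
private theorem coe_generalLinearGroup_map_inv (γ : GL n ℚ) :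
    (((Matrix.GeneralLinearGroup.map (algebraMap ℚ finAdeleQ) γ)⁻¹ : GL n finAdeleQ) : Matrix n n finAdeleQ) =
      ((γ⁻¹ : GL n ℚ) : Matrix n n ℚ).map (algebraMap ℚ finAdeleQ) := by
  rw [← map_inv]; rfl
omit [DecidableEq n] in
/-- `f ∘ (M q) = (M.map f) (f ∘ q)` for the diagonal embedding `f : ℚ → 𝔸_{ℚ,f}`. [folklore] -/
private theorem algebraMap_comp_mulVec (M : Matrix n n ℚ) (q : n → ℚ) :
    (⇑(algebraMap ℚ finAdeleQ) ∘ (M *ᵥ q)) = M.map (algebraMap ℚ finAdeleQ) *ᵥ (⇑(algebraMap ℚ finAdeleQ) ∘ q) := by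
  funext i
  exact RingHom.map_mulVec (algebraMap ℚ finAdeleQ) M q i
/-- The `(i, j)` entry of `M` is the `i`-th coordinate of `M eⱼ`. [folklore] -/
private theorem matrix_apply_eq_mulVec_single (M : Matrix n n finAdeleQ) (i j : n) :
    M i j = (M *ᵥ (Pi.single j 1 : n → finAdeleQ)) i := by
  classical
  simp [Matrix.mulVec, dotProduct, Pi.single_apply]

/-! ### §1. Level `N`: `Λ_a / N Λ_a ≃ (ℤ/N)ⁿ` through `q ↦ a⁻¹ q (mod N)` -/

/-- `N·𝓞̂` in the `integralFiniteAdeles` spelling: `x ∈ levelIdeal N ↔ x = N y` with `y ∈ ℤ̂` («`g ≡ 1 mod N`»).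
[cite: Deligne1971TravauxShimura, 4.16 p. 150] -/
theorem mem_levelIdeal_iff_exists_integralFiniteAdeles {N : ℕ} {x : finAdeleQ} :
    x ∈ levelIdeal N ↔ ∃ y ∈ integralFiniteAdeles ℚ, (N : finAdeleQ) * y = x := by
  rw [mem_levelIdeal_iff]
  constructor
  · rintro ⟨y, hy, h⟩
    exact ⟨y, (mem_integralAdeles_iff_mem_integralFiniteAdeles y).1 hy, h⟩
  · rintro ⟨y, hy, h⟩
    exact ⟨y, (mem_integralAdeles_iff_mem_integralFiniteAdeles y).2 hy, h⟩

omit [DecidableEq n] in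
/-- `ℤ̂ · N𝓞̂ ⊆ N𝓞̂` along a matrix–vector product: an integral matrix sends a vector with coordinates in `N·𝓞̂` to one with
coordinates in `N·𝓞̂` (`K(N)` is normalised by `K(1)`). [cite: Deligne1971TravauxShimura, 4.16 p. 150] -/
theorem mulVec_apply_mem_levelIdeal {N : ℕ} {M : Matrix n n finAdeleQ} (hM : ∀ i j, M i j ∈ integralFiniteAdeles ℚ)
    {y : n → finAdeleQ} (hy : ∀ j, y j ∈ levelIdeal N) (i : n) : (M *ᵥ y) i ∈ levelIdeal N := by
  rw [Matrix.mulVec, dotProduct]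
  exact AddSubgroup.sum_mem _ fun j _ =>
    Literature.AlgebraicGeometry.ModuliOfAbelianVarieties.mul_mem_levelIdeal_of_mem_integralAdeles
      ((mem_integralAdeles_iff_mem_integralFiniteAdeles _).2 (hM i j)) (hy j)

/-- **KERNEL of the level map**: `a⁻¹ q ∈ (N·ℤ̂)ⁿ` iff `q ∈ N Λ_a` — the map `q ↦ a⁻¹ q (mod N)` on `Λ_a` has kernel exactly
`N Λ_a`. [cite: Milne2005ShimuraVarieties, §6 Thm. 6.11 p. 74 and p. 75] [cite: Deligne1971TravauxShimura, 4.16–4.20 pp. 150–152] -/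
theorem forall_mulVec_mem_levelIdeal_iff {N : ℕ} (hN : N ≠ 0) (a : GL n finAdeleQ) (q : n → ℚ) :
    (∀ i, (((a⁻¹ : GL n finAdeleQ) : Matrix n n finAdeleQ) *ᵥ (⇑(algebraMap ℚ finAdeleQ) ∘ q)) i ∈ levelIdeal N) ↔
      ∃ p ∈ latticeOfGL a, q = (N : ℚ) • p := by
  have hNQ : (N : ℚ) ≠ 0 := Nat.cast_ne_zero.mpr hN
  have hsm : ∀ p : n → ℚ, (⇑(algebraMap ℚ finAdeleQ) ∘ ((N : ℚ) • p)) = (N : finAdeleQ) • (⇑(algebraMap ℚ finAdeleQ) ∘ p) := by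
    intro p; funext j
    simp only [Function.comp_apply, Pi.smul_apply, smul_eq_mul, map_mul, map_natCast]
  constructor
  · intro h
    refine ⟨(N : ℚ)⁻¹ • q, fun i => ?_, by rw [smul_smul, mul_inv_cancel₀ hNQ, one_smul]⟩
    obtain ⟨y, hy, hNy⟩ := mem_levelIdeal_iff_exists_integralFiniteAdeles.mp (h i)
    have hq : q = (N : ℚ) • ((N : ℚ)⁻¹ • q) := by rw [smul_smul, mul_inv_cancel₀ hNQ, one_smul]
    have hx : (N : finAdeleQ) * (((a⁻¹ : GL n finAdeleQ) : Matrix n n finAdeleQ) *ᵥ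
        (⇑(algebraMap ℚ finAdeleQ) ∘ ((N : ℚ)⁻¹ • q))) i = (N : finAdeleQ) * y := by
      rw [hNy, ← smul_eq_mul, ← Pi.smul_apply, ← Matrix.mulVec_smul, ← hsm, ← hq]
    have hunit := Literature.AlgebraicGeometry.ModuliOfAbelianVarieties.isUnit_natCast_finAdeleQ hN
    rw [hunit.mul_right_inj] at hx
    rw [hx]; exact hy
  · rintro ⟨p, hp, rfl⟩ i
    rw [hsm, Matrix.mulVec_smul, Pi.smul_apply, smul_eq_mul]
    exact mem_levelIdeal_iff_exists_integralFiniteAdeles.mpr ⟨_, hp i, rfl⟩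

/-- **SURJECTIVITY of the level map**: every `y ∈ ℤ̂ⁿ` is `a⁻¹ q (mod N)` for some `q ∈ Λ_a` (strong approximation
`𝔸_{ℚ,f} = ℚ + M ℤ̂` with `M = N N₁`, `N₁` a denominator of `a⁻¹`).  With the kernel computation: `q ↦ a⁻¹ q` induces
`Λ_a / N Λ_a ≃ (ℤ̂/Nℤ̂)ⁿ = (ℤ/N)ⁿ` — the level-`N` structure of the adelic point `a`.
[cite: Milne2005ShimuraVarieties, §6 Thm. 6.11 p. 74 and p. 75] [cite: Deligne1971TravauxShimura, 4.16–4.20 pp. 150–152] -/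
theorem exists_mem_latticeOfGL_mulVec_sub_mem_levelIdeal {N : ℕ} (hN : N ≠ 0) (a : GL n finAdeleQ) {y : n → finAdeleQ}
    (hy : ∀ j, y j ∈ integralFiniteAdeles ℚ) :
    ∃ q ∈ latticeOfGL a, ∀ i, (((a⁻¹ : GL n finAdeleQ) : Matrix n n finAdeleQ) *ᵥ
      (⇑(algebraMap ℚ finAdeleQ) ∘ q)) i - y i ∈ levelIdeal N := by
  obtain ⟨N₁, hN₁, -, hN₁'⟩ := exists_nat_mul_entries_mem a
  have hM : N * N₁ ≠ 0 := mul_ne_zero hN hN₁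
  set x : n → finAdeleQ := (a : Matrix n n finAdeleQ) *ᵥ y with hx
  choose k y' hy' hxy using fun l => exists_rat_add_natCast_mul (N * N₁) hM (x l)
  have hx_split : x = (⇑(algebraMap ℚ finAdeleQ) ∘ k) + fun l => ((N * N₁ : ℕ) : finAdeleQ) * y' l := funext hxy
  -- `w = a⁻¹ ((N N₁) y') = N · (N₁ a⁻¹) y'`
  set w : n → finAdeleQ := ((a⁻¹ : GL n finAdeleQ) : Matrix n n finAdeleQ) *ᵥ fun l => ((N * N₁ : ℕ) : finAdeleQ) * y' l
    with hw
  have hwN : ∀ i, ∃ z ∈ integralFiniteAdeles ℚ, (N : finAdeleQ) * z = w i := fun i => by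
    refine ⟨∑ l, ((N₁ : finAdeleQ) * ((a⁻¹ : GL n finAdeleQ) : Matrix n n finAdeleQ) i l) * y' l,
      sum_mem fun l _ => mul_mem (hN₁' i l) (hy' l), ?_⟩
    rw [hw, Matrix.mulVec, dotProduct, Finset.mul_sum]
    refine Finset.sum_congr rfl fun l _ => ?_
    rw [Nat.cast_mul]; ring
  have hk : ((a⁻¹ : GL n finAdeleQ) : Matrix n n finAdeleQ) *ᵥ (⇑(algebraMap ℚ finAdeleQ) ∘ k) = y - w := by
    have : (⇑(algebraMap ℚ finAdeleQ) ∘ k) = x - fun l => ((N * N₁ : ℕ) : finAdeleQ) * y' l := by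
      rw [hx_split, add_sub_cancel_right]
    rw [this, Matrix.mulVec_sub, hx, Matrix.mulVec_mulVec, ← Units.val_mul, inv_mul_cancel, Units.val_one,
      Matrix.one_mulVec]
  refine ⟨k, fun i => ?_, fun i => ?_⟩
  · rw [hk, Pi.sub_apply]
    obtain ⟨z, hz, hzw⟩ := hwN i
    rw [← hzw]
    exact sub_mem (hy i) (mul_mem (natCast_mem _ N) hz)
  · rw [hk, Pi.sub_apply, sub_sub_cancel_left]
    exact AddSubgroup.neg_mem _ (mem_levelIdeal_iff_exists_integralFiniteAdeles.mpr (hwN i))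


/-- **Integer representatives**: for `q ∈ Λ_a` the class `a⁻¹ q (mod N)` has an integer representative `z ∈ ℤⁿ`
(`ℤ̂/Nℤ̂ = ℤ/N`, ★ `exists_int_sub_intCast_mem_levelIdeal`), unique modulo `N` (★ `int_dvd_sub_of_sub_intCast_mem_levelIdeal`) —
so `q ↦ z mod N` is the level-`N` structure `Λ_a/NΛ_a ≃ (ℤ/N)ⁿ` read in `ℤ/N`. [cite: Milne2005ShimuraVarieties, §6 p. 75] -/
theorem exists_int_mulVec_sub_intCast_mem_levelIdeal {N : ℕ} (hN : N ≠ 0) {a : GL n finAdeleQ} {q : n → ℚ}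
    (hq : q ∈ latticeOfGL a) :
    ∃ z : n → ℤ, ∀ i, (((a⁻¹ : GL n finAdeleQ) : Matrix n n finAdeleQ) *ᵥ (⇑(algebraMap ℚ finAdeleQ) ∘ q)) i -
      ((z i : ℤ) : finAdeleQ) ∈ levelIdeal N := by
  choose z hz using fun i => exists_int_sub_intCast_mem_levelIdeal hN
    ((mem_integralAdeles_iff_mem_integralFiniteAdeles _).2 (hq i))
  exact ⟨z, hz⟩

/-- **`GL_n(ℚ)`-equivariance of the level map**: the coordinates of `γ q ∈ Λ_{γ a}` with respect to `γ a` are those of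
`q ∈ Λ_a` with respect to `a` — `(γa)⁻¹ (γ q) = a⁻¹ q` exactly. [cite: Milne2005ShimuraVarieties, §6 p. 75] -/
theorem inv_map_mul_mulVec_comp_mulVec (γ : GL n ℚ) (a : GL n finAdeleQ) (q : n → ℚ) :
    ((((Matrix.GeneralLinearGroup.map (algebraMap ℚ finAdeleQ) γ * a)⁻¹ : GL n finAdeleQ) : Matrix n n finAdeleQ) *ᵥ
      (⇑(algebraMap ℚ finAdeleQ) ∘ ((γ : Matrix n n ℚ) *ᵥ q))) =
      ((a⁻¹ : GL n finAdeleQ) : Matrix n n finAdeleQ) *ᵥ (⇑(algebraMap ℚ finAdeleQ) ∘ q) := by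
  rw [_root_.mul_inv_rev, Units.val_mul, ← Matrix.mulVec_mulVec, coe_generalLinearGroup_map_inv, algebraMap_comp_mulVec, Matrix.mulVec_mulVec,
    Matrix.mulVec_mulVec, Matrix.mul_assoc, ← RingHom.mapMatrix_apply, ← RingHom.mapMatrix_apply, ← map_mul,
    ← Units.val_mul, inv_mul_cancel, Units.val_one, map_one, Matrix.mul_one]

/-- **Right `GL_n(ℤ̂)`-translates re-mark the level structure**: for `u ∈ GL_n(ℤ̂)` (so `Λ_{a u} = Λ_a`) the coordinates
change by `u⁻¹`: `(a u)⁻¹ q = u⁻¹ (a⁻¹ q)`; hence if `u⁻¹ ≡ 1 (mod N)` the two level maps agree modulo `N`.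
[cite: Milne2005ShimuraVarieties, §6 p. 75] [cite: Deligne1971TravauxShimura, 4.16 p. 150] -/
theorem mulVec_sub_mulVec_mem_levelIdeal_of_isCongOne {N : ℕ} (a : GL n finAdeleQ) {u : GL n finAdeleQ}
    (hu : IsCongOne N (((u⁻¹ : GL n finAdeleQ) : Matrix n n finAdeleQ))) {q : n → ℚ} (hq : q ∈ latticeOfGL a) (i : n) :
    ((((a * u)⁻¹ : GL n finAdeleQ) : Matrix n n finAdeleQ) *ᵥ (⇑(algebraMap ℚ finAdeleQ) ∘ q)) i -
      (((a⁻¹ : GL n finAdeleQ) : Matrix n n finAdeleQ) *ᵥ (⇑(algebraMap ℚ finAdeleQ) ∘ q)) i ∈ levelIdeal N := by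
  set z : n → finAdeleQ := ((a⁻¹ : GL n finAdeleQ) : Matrix n n finAdeleQ) *ᵥ (⇑(algebraMap ℚ finAdeleQ) ∘ q) with hz
  have h : ((((a * u)⁻¹ : GL n finAdeleQ) : Matrix n n finAdeleQ) *ᵥ (⇑(algebraMap ℚ finAdeleQ) ∘ q)) - z =
      ((((u⁻¹ : GL n finAdeleQ) : Matrix n n finAdeleQ)) - 1) *ᵥ z := by
    rw [_root_.mul_inv_rev, Units.val_mul, ← Matrix.mulVec_mulVec, ← hz, Matrix.sub_mulVec, Matrix.one_mulVec]
  have h' := congrFun h i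
  rw [Pi.sub_apply] at h'
  rw [h', Matrix.mulVec, dotProduct]
  exact AddSubgroup.sum_mem _ fun j _ => by
    rw [mul_comm]
    exact Literature.AlgebraicGeometry.ModuliOfAbelianVarieties.mul_mem_levelIdeal_of_mem_integralAdeles
      ((mem_integralAdeles_iff_mem_integralFiniteAdeles _).2 (hq j)) (hu i j)

/-- **Conversely, the level map determines the coset modulo `K(N)`**: if `u ∈ GL_n(ℤ̂)` and the level maps of `a` and `a u`
agree modulo `N` on all of `Λ_a`, then `u⁻¹ ≡ 1 (mod N)` (test on `q ∈ Λ_a` with `a⁻¹ q ≡ eⱼ (mod N)`, which exist by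
surjectivity). [cite: Milne2005ShimuraVarieties, §6 p. 75] [cite: Deligne1971TravauxShimura, 4.16–4.20 pp. 150–152] -/
theorem isCongOne_inv_of_forall_mulVec_sub_mulVec_mem_levelIdeal {N : ℕ} (hN : N ≠ 0) (a : GL n finAdeleQ) {u : GL n finAdeleQ}
    (hu : u ∈ ((integralFiniteAdeles ℚ).matrix.toSubmonoid.units : Subgroup (GL n finAdeleQ)))
    (h : ∀ q ∈ latticeOfGL a, ∀ i,
      ((((a * u)⁻¹ : GL n finAdeleQ) : Matrix n n finAdeleQ) *ᵥ (⇑(algebraMap ℚ finAdeleQ) ∘ q)) i -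
        (((a⁻¹ : GL n finAdeleQ) : Matrix n n finAdeleQ) *ᵥ (⇑(algebraMap ℚ finAdeleQ) ∘ q)) i ∈ levelIdeal N) :
    IsCongOne N (((u⁻¹ : GL n finAdeleQ) : Matrix n n finAdeleQ)) := by
  classical
  rw [mem_units_matrix_integralFiniteAdeles_iff] at hu
  intro i j
  -- a lattice vector whose `a`-coordinates are `≡ eⱼ (mod N)`
  obtain ⟨q, hq, hqe⟩ := exists_mem_latticeOfGL_mulVec_sub_mem_levelIdeal hN a
    (y := (Pi.single j 1 : n → finAdeleQ)) (fun k => by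
      by_cases hk : k = j
      · subst hk; simp
      · simp [hk])
  set z : n → finAdeleQ := ((a⁻¹ : GL n finAdeleQ) : Matrix n n finAdeleQ) *ᵥ (⇑(algebraMap ℚ finAdeleQ) ∘ q) with hz
  -- `(u⁻¹ - 1) z ≡ 0` and `(u⁻¹ - 1)(z - eⱼ) ≡ 0`, hence `(u⁻¹ - 1) eⱼ ≡ 0`
  have h1 : ((((u⁻¹ : GL n finAdeleQ) : Matrix n n finAdeleQ) - 1) *ᵥ z) i ∈ levelIdeal N := by
    have := h q hq i
    rwa [_root_.mul_inv_rev, Units.val_mul, ← Matrix.mulVec_mulVec, ← hz, ← Pi.sub_apply, ← Matrix.one_mulVec z,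
      Matrix.mulVec_mulVec, Matrix.mul_one, ← Matrix.sub_mulVec] at this
  have h2 : ((((u⁻¹ : GL n finAdeleQ) : Matrix n n finAdeleQ) - 1) *ᵥ (z - Pi.single j 1)) i ∈ levelIdeal N := by
    refine mulVec_apply_mem_levelIdeal (fun k l => ?_) (fun l => hqe l) i
    rw [Matrix.sub_apply]
    refine sub_mem (hu.2 k l) ?_
    rw [Matrix.one_apply]
    split_ifs
    · exact one_mem _
    · exact zero_mem _
  have h3 := AddSubgroup.sub_mem _ h1 h2
  rw [Matrix.mulVec_sub, Pi.sub_apply, sub_sub_cancel] at h3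
  rwa [← matrix_apply_eq_mulVec_single] at h3

/-- `≡ 1 (mod N)` passes to inverses inside `GL_n(ℤ̂)`: `u⁻¹ - 1 = -u⁻¹ (u - 1)`. [cite: Deligne1971TravauxShimura, 4.16 p. 150] -/
theorem isCongOne_inv_of_isCongOne {N : ℕ} {u : GL n finAdeleQ}
    (hu : u ∈ ((integralFiniteAdeles ℚ).matrix.toSubmonoid.units : Subgroup (GL n finAdeleQ)))
    (h : IsCongOne N (u : Matrix n n finAdeleQ)) : IsCongOne N (((u⁻¹ : GL n finAdeleQ) : Matrix n n finAdeleQ)) := by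
  rw [mem_units_matrix_integralFiniteAdeles_iff] at hu
  intro i j
  have e : (((u⁻¹ : GL n finAdeleQ) : Matrix n n finAdeleQ)) - 1 =
      -((((u⁻¹ : GL n finAdeleQ) : Matrix n n finAdeleQ)) * ((u : Matrix n n finAdeleQ) - 1)) := by
    rw [Matrix.mul_sub, Matrix.mul_one, ← Units.val_mul, inv_mul_cancel, Units.val_one, neg_sub]
  rw [e, Matrix.neg_apply]
  refine AddSubgroup.neg_mem _ ?_
  rw [Matrix.mul_apply]
  exact AddSubgroup.sum_mem _ fun k _ =>
    Literature.AlgebraicGeometry.ModuliOfAbelianVarieties.mul_mem_levelIdeal_of_mem_integralAdeles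
      ((mem_integralAdeles_iff_mem_integralFiniteAdeles _).2 (hu.2 i k)) (h k j)

end Literature.NumberTheory.Adeles

end
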